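import Literature.GroupTheory.CombinatorialGroupTheory.CyclicAmalgamSyncedQuotient
import Literature.GroupTheory.CombinatorialGroupTheory.FiniteAmalgamTorsionConjugacy
import Mathlib.Algebra.Group.TypeTags.Finite
import HarnessLib

/-!
# Mixed pairs (elliptic vs. cyclically reduced of length `≥ 2`) in a cyclic amalgam of free groups
# are conjugacy-separated in a finite quotient

Topic `Literature/GroupTheory/CombinatorialGroupTheory`; theorems only, continuing
`CyclicAmalgamSyncedQuotient.lean` ("D5a", the synchronised finite-factor quotients
`Π : ∗_ℤ F(α_i) → ∗_{ℤ/L} (F(α_i)/N_i)`) and `FiniteAmalgamTorsionConjugacy.lean` ("D1a", mixed pairs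
in an amalgam of FINITE groups).  Let `P = ∗_ℤ F(α_i) = Monoid.PushoutI φ` (finitely many free
factors of finite rank, `φ_i : ℤ → F(α_i)` injective).  J. L. Dyer, *Separating conjugates in
amalgamated free products and HNN extensions*, J. Austral. Math. Soc. (A) 29 (1980), proof of Thm. 4
(p. 40), Cases 1 and 2 against Case 3: an element conjugate INTO A FACTOR (or the base group) and an
element conjugate to a CYCLICALLY REDUCED word of length `≥ 2` have non-conjugate images in some finite
quotient — project to a finite-factor quotient amalgam `P̄` keeping the letters of the word off the
amalgamated subgroup (*"`π_{M,N}(x)` is a cyclically reduced alternating product in `P_{M,N}` whose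
length is equal to `‖x‖`"*), where the first image has finite order and the second infinite order,
and use the residual finiteness of `P̄`.

* `exists_normal_finiteIndex_not_isConj_of_monoidHom` — bookkeeping: a pair separated in a finite
  quotient of the TARGET of a homomorphism is separated in a finite quotient of the source;
  `exists_normal_finiteIndex_not_isConj_of_conj` — separation of a pair is a property of the two
  conjugacy classes.
* `CyclicAmalgam.map_lprod_eq`, `CyclicAmalgam.mk_not_mem_range` — the synchronised quotient map acts
  letterwise and keeps the prescribed letters off the amalgamated `ℤ/L`;
  `CyclicAmalgam.not_isOfFinOrder_map_lprod` — so the image of a cyclically reduced word of length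
  `≥ 2` has infinite order in `P̄`.
* `CyclicAmalgam.exists_normal_finiteIndex_not_isConj_elliptic_hyperbolic` (and the primed version
  with the rôles exchanged) — **the mixed case**: `x` conjugate into the base group or a factor, `y`
  conjugate to a cyclically reduced word of length `≥ 2` ⇒ `x̄ ≁ ȳ` in `P ⧸ N` for some normal `N`
  of finite index.

This is one case of the finite-quotient route to the conjugacy separability of `∗_ℤ F(α_i)`
(Dyer 1980 Thm. 10), hence of orientable surface groups (Stebe 1972 Thm. 3.3, the tree's named fact
`SurfaceGroupConjugacySeparable`); nothing about the other cases is claimed here.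

## References

* J. L. Dyer, *Separating conjugates in amalgamated free products and HNN extensions*, J. Austral.
  Math. Soc. Ser. A 29 (1980) 35–51, proof of Thm. 4 p. 40, Thm. 10 p. 48. [Dyer1980]
* G. Baumslag, *On the residual finiteness of generalised free products of nilpotent groups*, Trans.
  Amer. Math. Soc. 106 (1963) 193–209, §§3–4. [Baumslag1963]
-/

namespace Literature.GroupTheory.CombinatorialGroupTheory

open Monoid Monoid.PushoutI Function

universe u v

/-! ### Bookkeeping: pulling a separating finite quotient back along a homomorphism -/

/-- If the images `f x`, `f y` are separated in a finite quotient of the target, then `x`, `y` are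
separated in a finite quotient of the source (take the kernel of the composite).
[cite: Dyer1980, Thm. 4 proof p.40] -/
theorem exists_normal_finiteIndex_not_isConj_of_monoidHom {P : Type u} {Q : Type v} [Group P]
    [Group Q] (f : P →* Q) {x y : P}
    (h : ∃ (M : Subgroup Q) (_ : M.Normal) (_ : M.FiniteIndex),
      ¬ IsConj (QuotientGroup.mk (f x) : Q ⧸ M) (QuotientGroup.mk (f y))) :
    ∃ (N : Subgroup P) (_ : N.Normal) (_ : N.FiniteIndex),
      ¬ IsConj (QuotientGroup.mk x : P ⧸ N) (QuotientGroup.mk y) := by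
  obtain ⟨M, hMn, hMf, hM⟩ := h
  let F : P →* Q ⧸ M := (QuotientGroup.mk' M).comp f
  haveI : Finite (Q ⧸ M) := Subgroup.finite_quotient_of_finiteIndex
  haveI : Finite (P ⧸ F.ker) := Finite.of_injective _ (QuotientGroup.kerLift_injective F)
  refine ⟨F.ker, inferInstance, Subgroup.finiteIndex_of_finite_quotient, fun hc => hM ?_⟩
  have := (QuotientGroup.kerLift F).map_isConj hc
  simpa [F] using this

/-- Separation in a finite quotient only depends on the conjugacy classes: it may be checked on
conjugates `p x p⁻¹`, `p' y p'⁻¹`. [cite: Dyer1980, Thm. 4 proof p.40] -/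
theorem exists_normal_finiteIndex_not_isConj_of_conj {P : Type u} [Group P] {x y : P} (p p' : P)
    (h : ∃ (N : Subgroup P) (_ : N.Normal) (_ : N.FiniteIndex),
      ¬ IsConj (QuotientGroup.mk (p * x * p⁻¹) : P ⧸ N) (QuotientGroup.mk (p' * y * p'⁻¹))) :
    ∃ (N : Subgroup P) (_ : N.Normal) (_ : N.FiniteIndex),
      ¬ IsConj (QuotientGroup.mk x : P ⧸ N) (QuotientGroup.mk y) := by
  obtain ⟨N, hNn, hNf, hN⟩ := h
  refine ⟨N, hNn, hNf, fun hc => hN ?_⟩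
  have hx : IsConj (QuotientGroup.mk x : P ⧸ N) (QuotientGroup.mk (p * x * p⁻¹)) :=
    isConj_iff.mpr ⟨QuotientGroup.mk p, by simp⟩
  have hy : IsConj (QuotientGroup.mk y : P ⧸ N) (QuotientGroup.mk (p' * y * p'⁻¹)) :=
    isConj_iff.mpr ⟨QuotientGroup.mk p', by simp⟩
  exact (hx.symm.trans hc).trans hy

namespace CyclicAmalgam

variable {ι : Type u} {α : ι → Type v}

/-- The value in `PushoutI φ` of a letter list. -/
local notation3 "ℓπ[" ψ "] " l:max =>
  List.prod (List.map (fun x => Monoid.PushoutI.of (φ := ψ) (Sigma.fst x) (Sigma.snd x)) l)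

/-! ### The synchronised quotient map on words -/

section Map

variable {φ : ∀ i, Multiplicative ℤ →* FreeGroup (α i)} {L : ℕ} {N : ∀ i, Subgroup (FreeGroup (α i))}
  [∀ i, (N i).Normal] {φq : ∀ i, Multiplicative (ZMod L) →* FreeGroup (α i) ⧸ N i}
  {Pmap : PushoutI φ →* PushoutI φq}

/-- The synchronised quotient map `Π : P → P̄` acts LETTERWISE on words: `Π (ℓπ w) = ℓπ w̄` with
`w̄` the word of residues. [cite: Dyer1980, Thm. 4 proof p.40] -/
theorem map_lprod_eq
    (hPof : ∀ i (g : FreeGroup (α i)),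
      Pmap ((of (φ := φ) i : FreeGroup (α i) →* PushoutI φ) g) =
        (of (φ := φq) i : (FreeGroup (α i) ⧸ N i) →* PushoutI φq) (QuotientGroup.mk g))
    (w : List (Σ i, FreeGroup (α i))) :
    Pmap (ℓπ[φ] w) =
      ℓπ[φq] (w.map fun z => (⟨z.1, (QuotientGroup.mk z.2 : FreeGroup (α z.1) ⧸ N z.1)⟩ :
        Σ i, FreeGroup (α i) ⧸ N i)) := by
  induction w with
  | nil => simp
  | cons z w ih =>
    simp only [List.map_cons, List.prod_cons, map_mul] at ih ⊢
    rw [ih, hPof]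

/-- A letter kept off `⟨c_i⟩ N_i` has its residue off the amalgamated `ℤ/L` of `P̄`.
[cite: Dyer1980, Thm. 4 proof p.40] -/
theorem mk_not_mem_range [NeZero L]
    (hφq : ∀ i (n : ℤ), φq i (Multiplicative.ofAdd ((n : ℤ) : ZMod L)) =
      QuotientGroup.mk (φ i (Multiplicative.ofAdd n)))
    {i : ι} {g : FreeGroup (α i)}
    (hg : g ∉ (((φ i).range ⊔ N i : Subgroup (FreeGroup (α i))) : Set (FreeGroup (α i)))) :
    (QuotientGroup.mk g : FreeGroup (α i) ⧸ N i) ∉ (φq i).range := by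
  rintro ⟨t, ht⟩
  obtain ⟨n, hn⟩ := ZMod.intCast_surjective (Multiplicative.toAdd t)
  have htn : t = Multiplicative.ofAdd ((n : ℤ) : ZMod L) := by rw [hn]; rfl
  rw [htn, hφq, QuotientGroup.eq] at ht
  apply hg
  have : g = φ i (Multiplicative.ofAdd n) * ((φ i (Multiplicative.ofAdd n))⁻¹ * g) := by group
  rw [SetLike.mem_coe, this]
  exact Subgroup.mul_mem_sup ⟨_, rfl⟩ ht

/-- The residue word of a word whose letters are kept off `⟨c_i⟩ N_i` is again a word with letters
off the amalgamated subgroup, with the same factor sequence; so **the image of a cyclically reduced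
word of length `≥ 2` has infinite order in `P̄`**. [cite: Dyer1980, Thm. 4 proof p.40] -/
theorem not_isOfFinOrder_map_lprod [NeZero L] (hφq_inj : ∀ i, Injective (φq i))
    (hPof : ∀ i (g : FreeGroup (α i)),
      Pmap ((of (φ := φ) i : FreeGroup (α i) →* PushoutI φ) g) =
        (of (φ := φq) i : (FreeGroup (α i) ⧸ N i) →* PushoutI φq) (QuotientGroup.mk g))
    (hφq : ∀ i (n : ℤ), φq i (Multiplicative.ofAdd ((n : ℤ) : ZMod L)) =
      QuotientGroup.mk (φ i (Multiplicative.ofAdd n)))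
    {w : List (Σ i, FreeGroup (α i))} (hwc : w.IsChain fun a b => a.1 ≠ b.1)
    (hwN : ∀ z ∈ w, z.2 ∉ (((φ z.1).range ⊔ N z.1 : Subgroup (FreeGroup (α z.1))) :
      Set (FreeGroup (α z.1))))
    (hw2 : 2 ≤ w.length) (hwcr : ∀ a ∈ w.getLast?, ∀ b ∈ w.head?, a.1 ≠ b.1) :
    ¬ IsOfFinOrder (Pmap (ℓπ[φ] w)) := by
  rw [map_lprod_eq hPof]
  refine Amalgam.not_isOfFinOrder_of_cyclicallyReduced hφq_inj ?_ ?_ ?_ ?_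
  · exact List.isChain_map _ |>.mpr hwc
  · intro z hz
    obtain ⟨z', hz', rfl⟩ := List.mem_map.mp hz
    exact mk_not_mem_range hφq (hwN z' hz')
  · simpa using hw2
  · intro a ha b hb
    rw [List.getLast?_map, Option.mem_def, Option.map_eq_some_iff] at ha
    rw [List.head?_map, Option.mem_def, Option.map_eq_some_iff] at hb
    obtain ⟨a', ha', rfl⟩ := ha
    obtain ⟨b', hb', rfl⟩ := hb
    exact hwcr a' ha' b' hb'

end Map

/-! ### The mixed case -/

/-- **Mixed pairs are conjugacy-separated** (Dyer 1980, proof of Thm. 4, `‖x‖ ≤ 1 < 2 ≤ ‖y‖`): in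
`P = ∗_ℤ F(α_i)` (finitely many free factors of finite rank, injective `φ_i`), if `x` is conjugate
into the base group or into a factor and `y` is conjugate to the value of a cyclically reduced word
of length `≥ 2`, then the images of `x` and `y` in `P ⧸ N` are not conjugate for some normal
subgroup `N` of finite index. [cite: Dyer1980, Thm. 4 proof p.40] -/
theorem exists_normal_finiteIndex_not_isConj_elliptic_hyperbolic [Finite ι] [Nonempty ι]
    [∀ i, Finite (α i)] (φ : ∀ i, Multiplicative ℤ →* FreeGroup (α i)) (hφ : ∀ i, Injective (φ i))
    {x y : PushoutI φ}
    (hx : ∃ p : PushoutI φ, (∃ c, p * x * p⁻¹ = base φ c) ∨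
      (∃ (i : ι) (g : FreeGroup (α i)), p * x * p⁻¹ = of i g))
    {w : List (Σ i, FreeGroup (α i))} (hwc : w.IsChain fun a b => a.1 ≠ b.1)
    (hwr : ∀ z ∈ w, z.2 ∉ (φ z.1).range) (hw2 : 2 ≤ w.length)
    (hwcr : ∀ a ∈ w.getLast?, ∀ b ∈ w.head?, a.1 ≠ b.1)
    (hy : ∃ p : PushoutI φ, p * y * p⁻¹ = ℓπ[φ] w) :
    ∃ (N : Subgroup (PushoutI φ)) (_ : N.Normal) (_ : N.FiniteIndex),
      ¬ IsConj (QuotientGroup.mk x : PushoutI φ ⧸ N) (QuotientGroup.mk y) := by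
  classical
  obtain ⟨p, hp⟩ := hx
  obtain ⟨p', hp'⟩ := hy
  refine exists_normal_finiteIndex_not_isConj_of_conj p p' ?_
  rw [hp']
  -- the letters of `w`, factor by factor, to be kept off the amalgamated subgroup
  let A : ∀ i, Set (FreeGroup (α i)) := fun i => {g | (⟨i, g⟩ : Σ i, FreeGroup (α i)) ∈ w}
  have hA : ∀ i, (A i).Finite := fun i =>
    (List.finite_toSet w).preimage sigma_mk_injective.injOn
  have hAc : ∀ i, Disjoint ((φ i).range : Set (FreeGroup (α i))) (A i) := by
    intro i
    refine Set.disjoint_left.mpr fun g hg hgA => ?_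
    exact hwr ⟨i, g⟩ hgA hg
  -- the synchronised finite-factor quotient `P̄ = ∗_{ℤ/L} (F(α_i)/N_i)`
  obtain ⟨L, N, hNn, φq, Pmap, -, hLpos, hNf, -, hφq_inj, -, hNA, hPof, hPbase, hφq⟩ :=
    exists_synced_quotientAmalgam φ hφ (fun _ => ⊤) A hA hAc 1 one_pos
  haveI : NeZero L := ⟨hLpos.ne'⟩
  haveI : ∀ i, Finite (FreeGroup (α i) ⧸ N i) := fun i => by
    haveI := hNf i
    exact Subgroup.finite_quotient_of_finiteIndex
  -- the image of `x` has finite order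
  have hxfin : IsOfFinOrder (Pmap (p * x * p⁻¹)) := by
    rcases hp with ⟨c, hc⟩ | ⟨i, g, hg⟩
    · rw [hc, show c = Multiplicative.ofAdd (Multiplicative.toAdd c) from rfl, hPbase]
      exact (base φq).isOfFinOrder (isOfFinOrder_of_finite _)
    · rw [hg, hPof]
      exact (of (φ := φq) i).isOfFinOrder (isOfFinOrder_of_finite _)
  -- the image of `y` has infinite order
  have hyinf : ¬ IsOfFinOrder (Pmap (ℓπ[φ] w)) :=
    not_isOfFinOrder_map_lprod hφq_inj hPof hφq hwc
      (fun z hz hzN => Set.disjoint_left.mp (hNA z.1) hzN (show z.2 ∈ A z.1 from hz)) hw2 hwcr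
  -- separate below and pull back
  exact exists_normal_finiteIndex_not_isConj_of_monoidHom Pmap
    (Amalgam.exists_normal_finiteIndex_not_isConj_mixed hφq_inj hxfin hyinf)

/-- The mixed case with the rôles exchanged: `x` conjugate to a cyclically reduced word of length
`≥ 2`, `y` conjugate into the base group or a factor. [cite: Dyer1980, Thm. 4 proof p.40] -/
theorem exists_normal_finiteIndex_not_isConj_hyperbolic_elliptic [Finite ι] [Nonempty ι]
    [∀ i, Finite (α i)] (φ : ∀ i, Multiplicative ℤ →* FreeGroup (α i)) (hφ : ∀ i, Injective (φ i))
    {x y : PushoutI φ}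
    {w : List (Σ i, FreeGroup (α i))} (hwc : w.IsChain fun a b => a.1 ≠ b.1)
    (hwr : ∀ z ∈ w, z.2 ∉ (φ z.1).range) (hw2 : 2 ≤ w.length)
    (hwcr : ∀ a ∈ w.getLast?, ∀ b ∈ w.head?, a.1 ≠ b.1)
    (hx : ∃ p : PushoutI φ, p * x * p⁻¹ = ℓπ[φ] w)
    (hy : ∃ p : PushoutI φ, (∃ c, p * y * p⁻¹ = base φ c) ∨
      (∃ (i : ι) (g : FreeGroup (α i)), p * y * p⁻¹ = of i g)) :
    ∃ (N : Subgroup (PushoutI φ)) (_ : N.Normal) (_ : N.FiniteIndex),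
      ¬ IsConj (QuotientGroup.mk x : PushoutI φ ⧸ N) (QuotientGroup.mk y) := by
  obtain ⟨N, hNn, hNf, hN⟩ :=
    exists_normal_finiteIndex_not_isConj_elliptic_hyperbolic φ hφ hy hwc hwr hw2 hwcr hx
  exact ⟨N, hNn, hNf, fun hc => hN hc.symm⟩

end CyclicAmalgam

end Literature.GroupTheory.CombinatorialGroupTheory
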